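import Literature.Analysis.FluidPDE.SobolevWholeSpace
import Mathlib.MeasureTheory.Integral.MeanInequalities
import HarnessLib

/-!
# Crux `SelfMixingDichotomy.CoherentScaleExclusion` (stmt-NavierStokesRegularity-1423), line
  `registered`: STUB N `stub_nashInequality` — the Nash inequality on `ℝ³`

Lands `--supports stmt-NavierStokesRegularity-1423` the registered stub `stub_nashInequality` of
the lead's skeleton `Cruxes/CoherentScaleExclusion/Lines/birth.lean` (reshape r2): there is
`C > 0` such that for every `C¹` function `f : ℝ³ → ℝ` with `f ∈ L¹`, `f ∈ L²`, `‖Df‖ ∈ L²`,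
`(∫ f²)⁵ ≤ C · (∫ |f|)⁴ · (∫ ‖Df‖²)³` (J. Nash, *Continuity of solutions of parabolic and elliptic
equations*, Amer. J. Math. 80 (1958); here `‖Df(x)‖` is the operator norm of the differential,
which for scalar `f` equals `‖∇f(x)‖`). It is the second ingredient of the drift-independent Nash
ceiling of the skeleton.

Proof.
1. `NashInequality.lintegral_sq_pow_five_le`: Hölder with exponents `4/5 + 1/5 = 1` applied to
   `g² = g^{4/5} · (g⁶)^{1/5}` (`ENNReal.lintegral_mul_norm_pow_le`) gives, for every
   a.e.-measurable `g ≥ 0` on any measure space, `(∫⁻ g²)⁵ ≤ (∫⁻ g)⁴ · ∫⁻ g⁶`.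
2. `NashInequality.lintegral_pow_six_le`: the tree's whole-space Gagliardo–Nirenberg–Sobolev
   inequality `Literature.Analysis.FluidPDE.eLpNorm_six_le_eLpNorm_fderiv_two`
   (`‖f‖_{L⁶} ≤ K ‖Df‖_{L²}` for `C¹` `f` with `‖f‖_{L²} < ∞`,
   `K = SNormLESNormFDerivOfEqConst ℝ volume 2`, `finrank_euclideanSpace_fin`), raised to the
   sixth power: `∫⁻ |f|⁶ ≤ K⁶ (∫⁻ ‖Df‖²)³`.
3. `stub_nashInequality`: combine 1–2 in `ℝ≥0∞` and pass to Bochner integrals of the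
   nonnegative integrands (`ofReal_integral_eq_lintegral_ofReal`), with `C = K⁶ + 1`.
-/

noncomputable section

open MeasureTheory
open scoped ENNReal NNReal

-- `Summit = Problem` for this summit; the tree lakefile sets `weak.linter.dupNamespace = false`.
set_option linter.dupNamespace false

namespace Summit.NavierStokesRegularity.NavierStokesRegularity.Theorems

open Literature.Analysis.FluidPDE

namespace NashInequality

/-- **Hölder interpolation** `(∫⁻ g²)⁵ ≤ (∫⁻ g)⁴ · ∫⁻ g⁶` for every a.e.-measurable
`g : α → ℝ≥0∞` (exponents `4/5 + 1/5 = 1` on `g² = g^{4/5} · (g⁶)^{1/5}`,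
`ENNReal.lintegral_mul_norm_pow_le`). -/
theorem lintegral_sq_pow_five_le {α : Type*} [MeasurableSpace α] {μ : Measure α}
    {g : α → ℝ≥0∞} (hg : AEMeasurable g μ) :
    (∫⁻ a, g a ^ 2 ∂μ) ^ 5 ≤ (∫⁻ a, g a ∂μ) ^ 4 * ∫⁻ a, g a ^ 6 ∂μ := by
  have h := ENNReal.lintegral_mul_norm_pow_le hg (hg.pow_const 6) (p := 4 / 5) (q := 1 / 5)
    (by norm_num) (by norm_num) (by norm_num)
  have hint : ∀ a, g a ^ (4 / 5 : ℝ) * (g a ^ 6) ^ (1 / 5 : ℝ) = g a ^ 2 := by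
    intro a
    have h6 : (g a ^ 6) ^ (1 / 5 : ℝ) = g a ^ (6 / 5 : ℝ) := by
      rw [← ENNReal.rpow_natCast, ← ENNReal.rpow_mul]
      norm_num
    rw [h6, ← ENNReal.rpow_add_of_nonneg _ _ (by norm_num : (0 : ℝ) ≤ 4 / 5)
      (by norm_num : (0 : ℝ) ≤ 6 / 5)]
    norm_num
  simp_rw [hint] at h
  calc (∫⁻ a, g a ^ 2 ∂μ) ^ 5
      ≤ ((∫⁻ a, g a ∂μ) ^ (4 / 5 : ℝ) * (∫⁻ a, g a ^ 6 ∂μ) ^ (1 / 5 : ℝ)) ^ 5 := by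
        gcongr
    _ = (∫⁻ a, g a ∂μ) ^ 4 * ∫⁻ a, g a ^ 6 ∂μ := by
        rw [mul_pow, ← ENNReal.rpow_mul_natCast, ← ENNReal.rpow_mul_natCast]
        norm_num

/-- **GNS, sixth power, on `ℝ³`:** for a `C¹` function `f : ℝ³ → ℝ` with `‖f‖_{L²} < ∞`,
`∫⁻ |f|⁶ ≤ K⁶ (∫⁻ ‖Df‖²)³` with `K = SNormLESNormFDerivOfEqConst ℝ volume 2` the constant of the
tree's whole-space Gagliardo–Nirenberg–Sobolev inequality
`Literature.Analysis.FluidPDE.eLpNorm_six_le_eLpNorm_fderiv_two`. -/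
theorem lintegral_pow_six_le {f : EuclideanSpace ℝ (Fin 3) → ℝ} (hf : ContDiff ℝ 1 f)
    (hf2 : eLpNorm f 2 volume < ∞) :
    ∫⁻ x, ‖f x‖ₑ ^ 6 ≤
      (SNormLESNormFDerivOfEqConst ℝ (volume : Measure (EuclideanSpace ℝ (Fin 3))) 2 : ℝ≥0∞) ^ 6 *
        (∫⁻ x, ‖fderiv ℝ f x‖ₑ ^ 2) ^ 3 := by
  have hGNS := eLpNorm_six_le_eLpNorm_fderiv_two (F := ℝ)
    (volume : Measure (EuclideanSpace ℝ (Fin 3))) finrank_euclideanSpace_fin hf hf2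
  have h6 : ∫⁻ x, ‖f x‖ₑ ^ 6 = eLpNorm f 6 volume ^ 6 := by
    have := eLpNorm_nnreal_pow_eq_lintegral (f := f)
      (μ := (volume : Measure (EuclideanSpace ℝ (Fin 3)))) (p := 6) (by norm_num)
    simp only [ENNReal.coe_ofNat, NNReal.coe_ofNat, ENNReal.rpow_ofNat] at this
    exact this.symm
  have h2 : ∫⁻ x, ‖fderiv ℝ f x‖ₑ ^ 2 = eLpNorm (fderiv ℝ f) 2 volume ^ 2 := by
    have := eLpNorm_nnreal_pow_eq_lintegral (f := fderiv ℝ f)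
      (μ := (volume : Measure (EuclideanSpace ℝ (Fin 3)))) (p := 2) (by norm_num)
    simp only [ENNReal.coe_ofNat, NNReal.coe_ofNat, ENNReal.rpow_ofNat] at this
    exact this.symm
  rw [h6, h2, ← pow_mul, show 2 * 3 = 6 by norm_num, ← mul_pow]
  gcongr

/-- **The Nash inequality on `ℝ³` with an explicit constant**: for a `C¹` function `f : ℝ³ → ℝ`
with `f ∈ L¹`, `f ∈ L²`, `‖Df‖ ∈ L²`, `(∫ f²)⁵ ≤ K⁶ · (∫ |f|)⁴ · (∫ ‖Df‖²)³`,
`K = SNormLESNormFDerivOfEqConst ℝ volume 2` (Nash 1958; Hölder + Gagliardo–Nirenberg–Sobolev). -/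
theorem nash {f : EuclideanSpace ℝ (Fin 3) → ℝ} (hf : ContDiff ℝ 1 f)
    (hf1 : Integrable f volume) (hf2 : Integrable (fun x => (f x) ^ 2) volume)
    (hDf : Integrable (fun x => ‖fderiv ℝ f x‖ ^ 2) volume) :
    (∫ x, (f x) ^ 2) ^ 5 ≤
      ((SNormLESNormFDerivOfEqConst ℝ (volume : Measure (EuclideanSpace ℝ (Fin 3))) 2 : ℝ≥0) : ℝ)
          ^ 6 * (∫ x, |f x|) ^ 4 * (∫ x, ‖fderiv ℝ f x‖ ^ 2) ^ 3 := by
  -- the three Bochner integrals as lower Lebesgue integrals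
  have hA : ENNReal.ofReal (∫ x, |f x|) = ∫⁻ x, ‖f x‖ₑ := by
    rw [← ofReal_integral_norm_eq_lintegral_enorm hf1]
    simp_rw [Real.norm_eq_abs]
  have hB : ENNReal.ofReal (∫ x, (f x) ^ 2) = ∫⁻ x, ‖f x‖ₑ ^ 2 := by
    rw [ofReal_integral_eq_lintegral_ofReal hf2 (ae_of_all _ fun x => sq_nonneg (f x))]
    refine lintegral_congr fun x => ?_
    rw [show (f x) ^ 2 = ‖f x‖ ^ 2 by rw [Real.norm_eq_abs, sq_abs],
      ENNReal.ofReal_pow (norm_nonneg _), ofReal_norm]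
  have hD : ENNReal.ofReal (∫ x, ‖fderiv ℝ f x‖ ^ 2) = ∫⁻ x, ‖fderiv ℝ f x‖ₑ ^ 2 := by
    rw [ofReal_integral_eq_lintegral_ofReal hDf (ae_of_all _ fun x => sq_nonneg _)]
    refine lintegral_congr fun x => ?_
    rw [ENNReal.ofReal_pow (norm_nonneg _), ofReal_norm]
  -- `f ∈ L²`
  have hL2 : eLpNorm f 2 volume < ∞ :=
    ((memLp_two_iff_integrable_sq hf.continuous.aestronglyMeasurable).2 hf2).eLpNorm_lt_top
  have hmeas : AEMeasurable (fun x => ‖f x‖ₑ) volume :=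
    hf.continuous.measurable.enorm.aemeasurable
  -- the inequality in `ℝ≥0∞`
  have key : (∫⁻ x, ‖f x‖ₑ ^ 2) ^ 5 ≤
      (SNormLESNormFDerivOfEqConst ℝ (volume : Measure (EuclideanSpace ℝ (Fin 3))) 2 : ℝ≥0∞) ^ 6 *
        (∫⁻ x, ‖f x‖ₑ) ^ 4 * (∫⁻ x, ‖fderiv ℝ f x‖ₑ ^ 2) ^ 3 :=
    calc (∫⁻ x, ‖f x‖ₑ ^ 2) ^ 5 ≤ (∫⁻ x, ‖f x‖ₑ) ^ 4 * ∫⁻ x, ‖f x‖ₑ ^ 6 :=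
          lintegral_sq_pow_five_le hmeas
      _ ≤ (∫⁻ x, ‖f x‖ₑ) ^ 4 *
          ((SNormLESNormFDerivOfEqConst ℝ (volume : Measure (EuclideanSpace ℝ (Fin 3))) 2 : ℝ≥0∞)
              ^ 6 * (∫⁻ x, ‖fderiv ℝ f x‖ₑ ^ 2) ^ 3) := by
          gcongr
          exact lintegral_pow_six_le hf hL2
      _ = _ := by ring
  -- back to real numbers
  have hA0 : 0 ≤ ∫ x, |f x| := integral_nonneg fun x => abs_nonneg _
  have hB0 : 0 ≤ ∫ x, (f x) ^ 2 := integral_nonneg fun x => sq_nonneg _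
  have hD0 : 0 ≤ ∫ x, ‖fderiv ℝ f x‖ ^ 2 := integral_nonneg fun x => sq_nonneg _
  have hK0 : (0 : ℝ) ≤
      ((SNormLESNormFDerivOfEqConst ℝ (volume : Measure (EuclideanSpace ℝ (Fin 3))) 2 : ℝ≥0) : ℝ) :=
    NNReal.coe_nonneg _
  rw [← hA, ← hB, ← hD, ← ENNReal.ofReal_pow hB0, ← ENNReal.ofReal_pow hA0,
    ← ENNReal.ofReal_pow hD0, ← ENNReal.ofReal_coe_nnreal, ← ENNReal.ofReal_pow hK0,
    ← ENNReal.ofReal_mul (pow_nonneg hK0 6),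
    ← ENNReal.ofReal_mul (mul_nonneg (pow_nonneg hK0 6) (pow_nonneg hA0 4)),
    ENNReal.ofReal_le_ofReal_iff
      (mul_nonneg (mul_nonneg (pow_nonneg hK0 6) (pow_nonneg hA0 4)) (pow_nonneg hD0 3))] at key
  exact key

end NashInequality

/-- **Stub N of the skeleton `Cruxes/CoherentScaleExclusion/Lines/birth.lean` — the Nash
inequality on `ℝ³`.** There is `C > 0` such that for every `C¹` function `f : ℝ³ → ℝ` with
`f ∈ L¹`, `f ∈ L²` and `‖Df‖ ∈ L²`: `(∫ f²)⁵ ≤ C · (∫ |f|)⁴ · (∫ ‖Df‖²)³` (Nash 1958; here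
`‖Df(x)‖` is the operator norm of the differential, `= ‖∇f(x)‖`). Proof: `NashInequality.nash`
with `C = K⁶ + 1`, `K = SNormLESNormFDerivOfEqConst ℝ volume 2` the constant of the tree's
whole-space Gagliardo–Nirenberg–Sobolev inequality
`Literature.Analysis.FluidPDE.eLpNorm_six_le_eLpNorm_fderiv_two`. -/
theorem stub_nashInequality :
    ∃ C : ℝ, 0 < C ∧ ∀ f : EuclideanSpace ℝ (Fin 3) → ℝ, ContDiff ℝ 1 f →
      MeasureTheory.Integrable f MeasureTheory.volume →
      MeasureTheory.Integrable (fun x => (f x) ^ 2) MeasureTheory.volume →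
      MeasureTheory.Integrable (fun x => ‖fderiv ℝ f x‖ ^ 2) MeasureTheory.volume →
      (∫ x, (f x) ^ 2) ^ 5 ≤ C * (∫ x, |f x|) ^ 4 * (∫ x, ‖fderiv ℝ f x‖ ^ 2) ^ 3 := by
  refine ⟨((SNormLESNormFDerivOfEqConst ℝ (volume : Measure (EuclideanSpace ℝ (Fin 3))) 2 :
      ℝ≥0) : ℝ) ^ 6 + 1, by positivity, fun f hf hf1 hf2 hDf => ?_⟩
  refine (NashInequality.nash hf hf1 hf2 hDf).trans ?_
  have hA0 : 0 ≤ (∫ x, |f x|) ^ 4 := pow_nonneg (integral_nonneg fun x => abs_nonneg _) 4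
  have hD0 : 0 ≤ (∫ x, ‖fderiv ℝ f x‖ ^ 2) ^ 3 :=
    pow_nonneg (integral_nonneg fun x => sq_nonneg _) 3
  refine mul_le_mul_of_nonneg_right (mul_le_mul_of_nonneg_right ?_ hA0) hD0
  linarith

end Summit.NavierStokesRegularity.NavierStokesRegularity.Theorems
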